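import Literature.NumberTheory.QuadraticFields.RealQuadraticClassNumberCycleBound
import HarnessLib

/-!
# Equivalent reduced ideals of a real quadratic field lie on the same cycle (Jacobson–Williams Thm. 5.18 for an
# arbitrary ideal class)

Topic `NumberTheory/QuadraticFields`, namespace `Literature.NumberTheory.QuadraticFields` (sub-namespace `QuadIrr` for the
continued-fraction side, `Quadratic` for the field side); continues `PrincipalCycleIdentification.lean` (Jozsa's Thm. 4(c) /
Jacobson–Williams Thm. 5.18 for the PRINCIPAL cycle: a reduced quotient with principal module lies on the principal cycle),
`ReducedIdealsPerClass.lean` (the ideal `𝔞(x) = (Q/2, ω − (t − P)/2)` of an ideal-shaped quotient; the class is constant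
along a cycle) and `RealQuadraticClassNumberCycleBound.lean` (`h_K ≤` number of cycles). Everything here is PROVED
(theorems only; no definition, no named fact). This is the converse direction needed to COUNT classes by cycles
(sequel `RealQuadraticClassNumberCycleCount.lean`: `h_K =` number of cycles, by certificate).

* `QuadIrr.one_lt_valProd_succ`; **`QuadIrr.exists_iterate_eq_of_jmod_eq_smul_of_isReduced`** — Thm. 5.18 for an
  ARBITRARY cycle: if `w₀, w` are reduced and their modules are homothetic, `J(w) = κ·J(w₀)` with `κ > 0` in `ℚ(√D)`,
  then `w = step^[n] w₀` for some `n` below the period of `w₀` (the principal proof verbatim with the fundamental unit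
  replaced by the unit `Π_ℓ(w₀)` of `w₀`'s own period `ℓ`: `1` is a minimum of `J(w)`, so `κ⁻¹Π_ℓ^{−j}` is a minimum of
  `J(w₀)` in `(Π_ℓ⁻¹, 1]`, hence one of the `β_n = Π_n⁻¹` (pinching, `eq_inv_valProd_of_isMinimum`), and `J(w) = J(x_n)`);
* `Quadratic.ringHom_eq_of_apply_eq` (two real embeddings agreeing at `ω` agree), **`Quadratic.exists_ringHom_sqrt`**
  (a real embedding `σ` with `σ(2ω − t) = +√D` exists: the two real embeddings differ at `ω`);
* `Quadratic.ringHom_combo`, `exists_mem_jmod_of_mem_span_fa`, `exists_mem_span_fa_of_mem_jmod` — under such `σ` the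
  ideal `𝔞(x)` is carried onto `(Q/2)·J(x)` (`mem_span_pair_iff_of_basis` + `ringHom_gen`); `isQD_ringHom`;
* **`Quadratic.exists_iterate_eq_of_mk0_eq`** — if `[𝔞(w)] = [𝔞(w₀)]` in `Cl(𝓞 K)` for reduced ideal-shaped `w₀, w`,
  then `w = step^[n] w₀` with `n` below the period of `w₀` (`(α)𝔞(w) = (β)𝔞(w₀)` from `ClassGroup.mk0_eq_mk0_iff`
  becomes `J(w) = κ·J(w₀)`, `κ = ±σ(β)a₀/(σ(α)a)`, under `σ`).

## References

* [JacobsonWilliams2008] M. J. Jacobson, Jr., H. C. Williams, *Solving the Pell Equation*, CMS Books in Mathematics,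
  Springer (2009), §5.3 Thm. 5.18 and (5.33)–(5.34).
* [Jozsa2003] R. Jozsa, arXiv:quant-ph/0302134 (2003), §6.3 Thm. 4(c), Prop. 29.
* [Cohen1993] H. Cohen, *A Course in Computational Algebraic Number Theory*, GTM 138, §5.6–§5.7.
-/

noncomputable section

open Module NumberField

namespace Literature.NumberTheory.QuadraticFields

namespace QuadIrr

variable {D : ℕ}

/-! ### Thm. 5.18 for an arbitrary cycle -/

/-- `Π_{m+1}(w₀) > 1` for a reduced `w₀` (each `φ_k > 1`). [cite: JacobsonWilliams2008, §5.3 (φ_k > 1 along a cycle)] -/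
theorem one_lt_valProd_succ (hD : ¬ IsSquare D) {w₀ : QuadIrr D} (hw₀ : w₀.IsReduced) (m : ℕ) :
    1 < valProd w₀ (m + 1) := by
  rw [valProd_succ]
  have h1 := one_le_valProd hD hw₀.isPreReduced m
  have h2 := (isReduced_iterate hD hw₀ (m + 1)).2.2.1
  nlinarith

/-- **A reduced quotient whose module is homothetic to that of a reduced `w₀` lies on the cycle of `w₀`**
(Jacobson–Williams Thm. 5.18 / Jozsa Thm. 4(c) for an arbitrary cycle): `J(w) = κ·J(w₀)`, `κ > 0` in `ℚ(√D)`, forces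
`w = step^[n] w₀` with `n` below the period of `w₀`. [cite: JacobsonWilliams2008, §5.3 Thm. 5.18] -/
theorem exists_iterate_eq_of_jmod_eq_smul_of_isReduced (hD : ¬ IsSquare D) {w₀ w : QuadIrr D}
    (hw₀ : w₀.IsReduced) (hw : w.IsReduced) {κ : ℝ} (hκ : 0 < κ) (hκQ : IsQD D κ)
    (hJ : ∀ t, t ∈ jmod w ↔ ∃ s ∈ jmod w₀, t = κ * s) :
    ∃ n : ℕ, n < Function.minimalPeriod step w₀ ∧ w = step^[n] w₀ := by
  have h0 : w₀.IsPreReduced := hw₀.isPreReduced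
  set ℓ := Function.minimalPeriod step w₀ with hℓ
  have hℓ1 : 1 ≤ ℓ := minimalPeriod_pos hD hw₀
  have hfix : step^[ℓ] w₀ = w₀ := Function.iterate_minimalPeriod
  set ε := valProd w₀ ℓ with hεdef
  have hε1 : 1 < ε := by
    obtain ⟨m, hm⟩ : ∃ m, ℓ = m + 1 := ⟨ℓ - 1, by omega⟩
    rw [hεdef, hm]; exact one_lt_valProd_succ hD hw₀ m
  have hε0 : 0 < ε := by linarith
  have hεQ : IsQD D ε := isQD_valProd w₀ ℓ
  -- `J(w₀)` is invariant under multiplication by `ε^{±1}`, hence by `ε^m`, `m ∈ ℤ`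
  have hO : ∀ t, (∃ s ∈ jmod w₀, t = ε * s) ↔ t ∈ jmod w₀ := by
    intro t
    rw [← mem_jmod_iterate_iff hD h0 ℓ t, hfix]
  have hεnat : ∀ k : ℕ, ∀ s ∈ jmod w₀, ε ^ k * s ∈ jmod w₀ ∧ (ε ^ k)⁻¹ * s ∈ jmod w₀ := by
    intro k
    induction k with
    | zero => intro s hs; simpa using hs
    | succ k ih =>
      intro s hs
      obtain ⟨h1, h2⟩ := ih s hs
      constructor
      · rw [pow_succ, mul_comm (ε ^ k) ε, mul_assoc]
        exact (hO _).mp ⟨ε ^ k * s, h1, rfl⟩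
      · obtain ⟨s', hs', hs's⟩ := (hO _).mpr h2
        have e : s = ε ^ k * (ε * s') := by
          have h : ε ^ k * ((ε ^ k)⁻¹ * s) = ε ^ k * (ε * s') := congrArg (fun t => ε ^ k * t) hs's
          rw [← mul_assoc, mul_inv_cancel₀ (pow_ne_zero _ hε0.ne'), one_mul] at h
          exact h
        have : (ε ^ (k + 1))⁻¹ * s = s' := by
          rw [e, pow_succ]; field_simp
        rw [this]; exact hs'
  have hεz : ∀ m : ℤ, ∀ s ∈ jmod w₀, ε ^ m * s ∈ jmod w₀ := by
    intro m s hs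
    rcases Int.eq_nat_or_neg m with ⟨k, rfl | rfl⟩
    · rw [zpow_natCast]; exact (hεnat k s hs).1
    · rw [zpow_neg, zpow_natCast]; exact (hεnat k s hs).2
  -- `λ = κ⁻¹` is a minimum of `J(w₀)`
  set lam := κ⁻¹ with hlam
  have hlam0 : 0 < lam := inv_pos.mpr hκ
  have hset : {u | ∃ μ ∈ (jmod w : Set ℝ), u = lam * μ} = (jmod w₀ : Set ℝ) := by
    ext u
    simp only [Set.mem_setOf_eq, SetLike.mem_coe]
    constructor
    · rintro ⟨μ, hμ, rfl⟩
      obtain ⟨s, hs, rfl⟩ := (hJ μ).mp hμ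
      have : lam * (κ * s) = s := by rw [hlam]; field_simp
      rw [this]; exact hs
    · intro hu
      exact ⟨κ * u, (hJ _).mpr ⟨u, hu, rfl⟩, by rw [hlam]; field_simp⟩
  have hminl : IsMinimum D (jmod w₀ : Set ℝ) lam := by
    have := isMinimum_smul hD hlam0 (hκQ.inv hD) (fun μ hμ => isQD_of_mem_jmod hμ) (isMinimum_one_of_isReduced hD hw)
    rwa [hset, mul_one] at this
  -- unit adjustment: `λ' = λ ε^{-(m+1)} ∈ (ε⁻¹, 1]`
  obtain ⟨m, hm1, hm2⟩ := exists_mem_Ioc_zpow hlam0 hε1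
  set c := (ε ^ (m + 1))⁻¹ with hc
  have hc0 : 0 < c := inv_pos.mpr (zpow_pos hε0 _)
  have hcQ : IsQD D c := (hεQ.zpow hD (m + 1)).inv hD
  set lam' := c * lam with hlam'
  have hlam'1 : lam' ≤ 1 := by
    rw [hlam', hc, inv_mul_le_iff₀ (zpow_pos hε0 _), mul_one]; exact hm2
  have hlam'2 : ε⁻¹ < lam' := by
    rw [hlam', hc]
    have : ε ^ m = ε ^ (m + 1) * ε⁻¹ := by rw [zpow_add_one₀ hε0.ne']; field_simp
    rw [this] at hm1
    rw [lt_inv_mul_iff₀ (zpow_pos hε0 _)]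
    linarith
  have hset' : {u | ∃ μ ∈ (jmod w₀ : Set ℝ), u = c * μ} = (jmod w₀ : Set ℝ) := by
    ext u
    simp only [Set.mem_setOf_eq, SetLike.mem_coe]
    constructor
    · rintro ⟨μ, hμ, rfl⟩
      rw [hc, ← zpow_neg]; exact hεz _ μ hμ
    · intro hu
      refine ⟨ε ^ (m + 1) * u, hεz _ u hu, ?_⟩
      rw [hc]; field_simp
  have hminl2 : IsMinimum D (jmod w₀ : Set ℝ) lam' := by
    have := isMinimum_smul hD hc0 hcQ (fun μ hμ => isQD_of_mem_jmod hμ) hminl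
    rwa [hset'] at this
  -- pinching: `λ' = β_N`
  obtain ⟨N, hN⟩ := eq_inv_valProd_of_isMinimum hD h0 hminl2 hlam'1
  -- `N < ℓ` since `β_N = λ' > ε⁻¹ = β_ℓ` and `β` is decreasing
  have hNℓ : N < ℓ := by
    by_contra hge
    push Not at hge
    have hmono : valProd w₀ ℓ ≤ valProd w₀ N := by
      obtain ⟨d, rfl⟩ := Nat.exists_eq_add_of_le hge
      clear hN hge
      induction d with
      | zero => simp
      | succ d ih =>
        rw [← Nat.add_assoc, valProd_succ]
        have := (isReduced_iterate hD hw₀ (ℓ + d + 1)).2.2.1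
        have := valProd_pos hD h0 (ℓ + d)
        nlinarith
    have : (valProd w₀ N)⁻¹ ≤ (valProd w₀ ℓ)⁻¹ := inv_anti₀ (valProd_pos hD h0 ℓ) hmono
    rw [← hN] at this
    exact absurd (lt_of_lt_of_le hlam'2 this) (lt_irrefl _)
  -- `κ = Π_N ε^{-(m+1)}`
  have hκ_eq : κ = valProd w₀ N * ε ^ (-(m + 1)) := by
    have : lam' = c * κ⁻¹ := rfl
    rw [hN, hc] at this
    have hPi0 := (valProd_pos hD h0 N).ne'
    have hz0 : ε ^ (m + 1) ≠ 0 := (zpow_pos hε0 _).ne'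
    rw [zpow_neg]
    field_simp at this ⊢
    linarith
  -- `J(w) = J(step^N w₀)`
  have hJN : ∀ t, t ∈ jmod w ↔ t ∈ jmod (step^[N] w₀) := by
    intro t
    rw [hJ, mem_jmod_iterate_iff hD h0 N]
    constructor
    · rintro ⟨s, hs, rfl⟩
      refine ⟨ε ^ (-(m + 1)) * s, hεz _ s hs, ?_⟩
      rw [hκ_eq]; ring
    · rintro ⟨s, hs, rfl⟩
      refine ⟨ε ^ (m + 1) * s, hεz _ s hs, ?_⟩
      rw [hκ_eq, mul_assoc, ← mul_assoc (ε ^ (-(m + 1))), ← zpow_add₀ hε0.ne']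
      simp
  exact ⟨N, hNℓ, eq_of_jmod_eq hD hw (isReduced_iterate hD hw₀ N) hJN⟩

end QuadIrr

/-! ### The field side: embeddings, the ideal `𝔞(x)` under `σ`, and classes ↦ cycles -/

namespace Quadratic

open QuadIrr
open scoped nonZeroDivisors

section Embedding

variable {K : Type*} [Field K] [NumberField K]
variable (b : Basis (Fin 2) ℤ (𝓞 K)) (hb : b 0 = 1) {t m : ℤ} (hω : b 1 * b 1 = (m : 𝓞 K) + (t : 𝓞 K) * b 1)

include hb in
/-- Two real embeddings of a quadratic field which agree at `ω` are equal (`K = ℚ(ω)`). [cite: Cohen1993, §5.1 (quadratic fields and their embeddings)] -/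
theorem ringHom_eq_of_apply_eq {σ σ' : K →+* ℝ} (h : σ (b 1 : K) = σ' (b 1 : K)) : σ = σ' := by
  have key : ∀ y : 𝓞 K, σ (y : K) = σ' (y : K) := by
    intro y
    have e := eq_repr_add_repr_mul_of_basis b hb y
    have h1 : σ (((b.repr y 0 : 𝓞 K) + (b.repr y 1 : 𝓞 K) * b 1 : 𝓞 K) : K) =
        σ' (((b.repr y 0 : 𝓞 K) + (b.repr y 1 : 𝓞 K) * b 1 : 𝓞 K) : K) := by
      rw [RingOfIntegers.coe_eq_algebraMap, map_add, map_mul, map_intCast, map_intCast, map_add, map_mul,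
        map_intCast, map_intCast, map_add, map_mul, map_intCast, map_intCast, ← RingOfIntegers.coe_eq_algebraMap, h]
    rw [← e] at h1
    exact h1
  refine RingHom.ext fun z => ?_
  obtain ⟨a, c, -, rfl⟩ := IsFractionRing.div_surjective (A := 𝓞 K) z
  rw [map_div₀, map_div₀, ← RingOfIntegers.coe_eq_algebraMap, ← RingOfIntegers.coe_eq_algebraMap, key a, key c]

include hb hω in
/-- **A real embedding with `σ(2ω − t) = +√D`** exists for a real quadratic field (of the two real embeddings, which
differ at `ω`, one has each sign of `σ(2ω − t) = ±√D`). [cite: Cohen1993, §5.1 (the two real embeddings of a real quadratic field)] -/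
theorem exists_ringHom_sqrt (h2 : finrank ℚ K = 2) (hd : 0 < NumberField.discr K) {D : ℕ}
    (hDt : (D : ℤ) = t ^ 2 + 4 * m) : ∃ σ : K →+* ℝ, 2 * σ (b 1 : K) - t = Real.sqrt D := by
  classical
  obtain ⟨hr, -⟩ := nrRealPlaces_eq_two_and_nrComplexPlaces_eq_zero h2 hd
  have hcard : 1 < Fintype.card {φ : K →+* ℂ // ComplexEmbedding.IsReal φ} := by
    rw [NumberField.InfinitePlace.card_real_embeddings, hr]; norm_num
  obtain ⟨φ₀, φ₁, hne⟩ := Fintype.exists_pair_of_one_lt_card hcard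
  have hsq : ∀ σ : K →+* ℝ, 2 * σ (b 1 : K) - t = Real.sqrt D ∨ 2 * σ (b 1 : K) - t = -Real.sqrt D := by
    intro σ
    apply sq_eq_sq_iff_eq_or_eq_neg.mp
    rw [ringHom_delta_sq b hω σ, QuadIrr.sqrt_sq]
    exact_mod_cast hDt.symm
  rcases hsq φ₀.2.embedding with h0 | h0
  · exact ⟨_, h0⟩
  rcases hsq φ₁.2.embedding with h1 | h1
  · exact ⟨_, h1⟩
  exfalso
  apply hne
  have hb1 : φ₀.2.embedding (b 1 : K) = φ₁.2.embedding (b 1 : K) := by linarith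
  have heq := ringHom_eq_of_apply_eq b hb hb1
  apply Subtype.ext
  refine RingHom.ext fun z => ?_
  rw [← ComplexEmbedding.IsReal.coe_embedding_apply φ₀.2 z, ← ComplexEmbedding.IsReal.coe_embedding_apply φ₁.2 z, heq]

variable {D : ℕ} (hDt : (D : ℤ) = t ^ 2 + 4 * m) (σ : K →+* ℝ) (hσ : 2 * σ (b 1 : K) - t = Real.sqrt D)

include hDt hσ in
/-- `σ(u·(Q/2) + v·η(x)) = (Q/2)(u + vφ)` for the generator `η(x) = ω − (t − P)/2` of `𝔞(x)` (`σ(η) = (P + √D)/2 = (Q/2)φ`).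
[cite: JacobsonWilliams2008, §5.3 (the ideal [Q/r, (P + √D)/r])] -/
theorem ringHom_combo {x : QuadIrr D} (h : x.IsIdealShaped) (u v : ℤ) :
    σ ((((u : 𝓞 K) * ((fa x : ℤ) : 𝓞 K) + (v : 𝓞 K) * (b 1 - (((t - x.P) / 2 : ℤ) : 𝓞 K)) : 𝓞 K) : K)) =
      fa x * (u + v * x.val) := by
  have hgen := ringHom_gen b hDt σ hσ h
  obtain ⟨k, C, hpos, hQ, -, -, -, -⟩ := exists_form_of_isIdealShaped b hDt h
  rw [RingOfIntegers.coe_eq_algebraMap] at hgen ⊢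
  rw [map_add, map_mul, map_mul, map_intCast, map_intCast, map_intCast, map_add, map_mul, map_mul,
    map_intCast, map_intCast, map_intCast, hgen]
  have hQr : (x.Q : ℝ) = 2 * fa x := by exact_mod_cast hQ
  have hfa0 : (fa x : ℝ) ≠ 0 := by exact_mod_cast hpos.ne'
  unfold val
  rw [hQr]
  field_simp

include hb hω hDt hσ in
/-- **`σ` carries `𝔞(x) = (Q/2, ω − (t − P)/2)` onto `(Q/2)·J(x)`**, `J(x) = ℤ + φℤ`: the image of an element of the
ideal. [cite: JacobsonWilliams2008, §5.3 (the ideal [Q/r, (P + √D)/r])] -/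
theorem exists_mem_jmod_of_mem_span_fa {x : QuadIrr D} (h : x.IsIdealShaped) {z : 𝓞 K}
    (hz : z ∈ Ideal.span {((fa x : ℤ) : 𝓞 K), b 1 - (((t - x.P) / 2 : ℤ) : 𝓞 K)}) :
    ∃ u ∈ jmod x, σ (z : K) = fa x * u := by
  obtain ⟨k, C, hpos, hQ, hP, hAC, hη, hI⟩ := exists_form_of_isIdealShaped b hDt h
  rw [hI] at hz
  obtain ⟨u, v, rfl⟩ := (mem_span_pair_iff_of_basis b hb hω hAC z).mp hz
  refine ⟨u + v * x.val, intCast_add_mul_val_mem_jmod x u v, ?_⟩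
  rw [← hη]
  exact ringHom_combo b hDt σ hσ h u v

include hb hω hDt hσ in
/-- Conversely every element of `(Q/2)·J(x)` is the image of an element of `𝔞(x)`.
[cite: JacobsonWilliams2008, §5.3 (the ideal [Q/r, (P + √D)/r])] -/
theorem exists_mem_span_fa_of_mem_jmod {x : QuadIrr D} (h : x.IsIdealShaped) {u : ℝ} (hu : u ∈ jmod x) :
    ∃ z ∈ Ideal.span {((fa x : ℤ) : 𝓞 K), b 1 - (((t - x.P) / 2 : ℤ) : 𝓞 K)}, σ (z : K) = fa x * u := by
  obtain ⟨k, C, hpos, hQ, hP, hAC, hη, hI⟩ := exists_form_of_isIdealShaped b hDt h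
  obtain ⟨c, d, rfl⟩ := mem_jmod_iff.mp hu
  refine ⟨(c : 𝓞 K) * ((fa x : ℤ) : 𝓞 K) + (d : 𝓞 K) * (b 1 - (((t - x.P) / 2 : ℤ) : 𝓞 K)), ?_,
    ringHom_combo b hDt σ hσ h c d⟩
  rw [hI, hη]
  exact (mem_span_pair_iff_of_basis b hb hω hAC _).mpr ⟨c, d, rfl⟩

include hσ in
omit [NumberField K] in
/-- `σ(α) ∈ ℚ(√D)` for `α ∈ 𝓞 K`. [cite: Cohen1993, §5.1] -/
theorem isQD_ringHom (hb : b 0 = 1) (α : 𝓞 K) : IsQD D (σ (α : K)) := by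
  have e := eq_repr_add_repr_mul_of_basis b hb α
  have h1 : σ (α : K) = b.repr α 0 + b.repr α 1 * σ (b 1 : K) := by
    conv_lhs => rw [e, RingOfIntegers.coe_eq_algebraMap]
    rw [map_add, map_mul, map_intCast, map_intCast, map_add, map_mul, map_intCast, map_intCast,
      ← RingOfIntegers.coe_eq_algebraMap]
  have hω' : σ (b 1 : K) = qd D (t / 2) (1 / 2) := by unfold qd; push_cast; linarith
  rw [h1, hω']
  exact (IsQD.intCast _).add ((IsQD.intCast _).mul ⟨_, _, rfl⟩)

end Embedding

section Classes

variable {K : Type*} [Field K] [NumberField K]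
variable (b : Basis (Fin 2) ℤ (𝓞 K)) (hb : b 0 = 1) {t m : ℤ} (hω : b 1 * b 1 = (m : 𝓞 K) + (t : 𝓞 K) * b 1)
variable {D : ℕ} (hDt : (D : ℤ) = t ^ 2 + 4 * m)

include hb hω hDt in
/-- **Equivalent reduced ideals lie on the same cycle** (Jacobson–Williams Thm. 5.18): if the ideals `𝔞(w₀)`, `𝔞(w)`
of two reduced ideal-shaped quotients have the same class, then `w = step^[n] w₀` with `n` below the period of `w₀`
(`(α)𝔞(w) = (β)𝔞(w₀)` becomes `J(w) = κ·J(w₀)` under a real embedding, and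
`exists_iterate_eq_of_jmod_eq_smul_of_isReduced` applies). [cite: JacobsonWilliams2008, §5.3 Thm. 5.18] -/
theorem exists_iterate_eq_of_mk0_eq (hD : ¬ IsSquare D) (h2 : finrank ℚ K = 2) (hd : 0 < NumberField.discr K)
    {w₀ w : QuadIrr D} (hs₀ : w₀.IsIdealShaped) (hr₀ : w₀.IsReduced) (hs : w.IsIdealShaped) (hr : w.IsReduced)
    (hI₀ : Ideal.span {((fa w₀ : ℤ) : 𝓞 K), b 1 - (((t - w₀.P) / 2 : ℤ) : 𝓞 K)} ∈ (Ideal (𝓞 K))⁰)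
    (hI : Ideal.span {((fa w : ℤ) : 𝓞 K), b 1 - (((t - w.P) / 2 : ℤ) : 𝓞 K)} ∈ (Ideal (𝓞 K))⁰)
    (heq : ClassGroup.mk0 ⟨_, hI⟩ = ClassGroup.mk0 ⟨_, hI₀⟩) :
    ∃ n : ℕ, n < Function.minimalPeriod step w₀ ∧ w = step^[n] w₀ := by
  obtain ⟨σ, hσ⟩ := exists_ringHom_sqrt b hb hω h2 hd hDt
  rw [ClassGroup.mk0_eq_mk0_iff] at heq
  obtain ⟨α, β, hα0, hβ0, hαβ⟩ := heq
  have ha0 : (0 : ℝ) < fa w₀ := by have := hs₀.1; have := hs₀.2.1; unfold fa; exact_mod_cast (by omega)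
  have ha : (0 : ℝ) < fa w := by have := hs.1; have := hs.2.1; unfold fa; exact_mod_cast (by omega)
  have hσα : σ (α : K) ≠ 0 := by
    rw [map_ne_zero]; exact_mod_cast hα0
  have hσβ : σ (β : K) ≠ 0 := by
    rw [map_ne_zero]; exact_mod_cast hβ0
  -- the two images coincide
  have key : ∀ r : ℝ, (∃ u ∈ jmod w, r = σ (α : K) * (fa w * u)) ↔
      (∃ s ∈ jmod w₀, r = σ (β : K) * (fa w₀ * s)) := by
    intro r
    constructor
    · rintro ⟨u, hu, rfl⟩
      obtain ⟨z, hz, hzu⟩ := exists_mem_span_fa_of_mem_jmod b hb hω hDt σ hσ hs hu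
      have hmem : α * z ∈ Ideal.span {β} * Ideal.span {((fa w₀ : ℤ) : 𝓞 K), b 1 - (((t - w₀.P) / 2 : ℤ) : 𝓞 K)} := by
        rw [← hαβ]; exact Ideal.mem_span_singleton_mul.mpr ⟨z, hz, rfl⟩
      obtain ⟨z₀, hz₀, hzz⟩ := Ideal.mem_span_singleton_mul.mp hmem
      obtain ⟨s, hs', hs₀⟩ := exists_mem_jmod_of_mem_span_fa b hb hω hDt σ hσ hs₀ hz₀
      refine ⟨s, hs', ?_⟩
      rw [← hzu, ← hs₀, ← map_mul σ, ← map_mul σ]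
      congr 1
      have := congrArg (fun y : 𝓞 K => (y : K)) hzz
      push_cast at this
      exact this.symm
    · rintro ⟨s, hs', rfl⟩
      obtain ⟨z₀, hz₀, hzs⟩ := exists_mem_span_fa_of_mem_jmod b hb hω hDt σ hσ hs₀ hs'
      have hmem : β * z₀ ∈ Ideal.span {α} * Ideal.span {((fa w : ℤ) : 𝓞 K), b 1 - (((t - w.P) / 2 : ℤ) : 𝓞 K)} := by
        rw [hαβ]; exact Ideal.mem_span_singleton_mul.mpr ⟨z₀, hz₀, rfl⟩
      obtain ⟨z, hz, hzz⟩ := Ideal.mem_span_singleton_mul.mp hmem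
      obtain ⟨u, hu, hzu⟩ := exists_mem_jmod_of_mem_span_fa b hb hω hDt σ hσ hs hz
      refine ⟨u, hu, ?_⟩
      rw [← hzs, ← hzu, ← map_mul σ, ← map_mul σ]
      congr 1
      have := congrArg (fun y : 𝓞 K => (y : K)) hzz
      push_cast at this
      exact this.symm
  -- `J(w) = κ J(w₀)`
  set κ : ℝ := σ (β : K) * fa w₀ / (σ (α : K) * fa w) with hκ
  have hκ0 : κ ≠ 0 := by
    rw [hκ]; exact div_ne_zero (mul_ne_zero hσβ ha0.ne') (mul_ne_zero hσα ha.ne')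
  have hJ : ∀ t', t' ∈ jmod w ↔ ∃ s ∈ jmod w₀, t' = κ * s := by
    intro t'
    constructor
    · intro ht'
      obtain ⟨s, hs', hs''⟩ := (key _).mp ⟨t', ht', rfl⟩
      refine ⟨s, hs', ?_⟩
      rw [hκ]; field_simp; linarith
    · rintro ⟨s, hs', rfl⟩
      obtain ⟨u, hu, hu'⟩ := (key _).mpr ⟨s, hs', rfl⟩
      have : κ * s = u := by
        rw [hκ]; field_simp; linarith
      rw [this]; exact hu
  have hκQ : IsQD D κ := by
    rw [hκ]
    exact ((isQD_ringHom b σ hσ hb β).mul (IsQD.intCast _)).mul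
      (((isQD_ringHom b σ hσ hb α).mul (IsQD.intCast _)).inv hD)
  -- make `κ` positive
  rcases lt_or_gt_of_ne hκ0 with hneg | hpos
  · refine exists_iterate_eq_of_jmod_eq_smul_of_isReduced hD hr₀ hr (neg_pos.mpr hneg) hκQ.neg fun t' => ?_
    rw [hJ]
    constructor
    · rintro ⟨s, hs', rfl⟩; exact ⟨-s, neg_mem hs', by ring⟩
    · rintro ⟨s, hs', rfl⟩; exact ⟨-s, neg_mem hs', by ring⟩
  · exact exists_iterate_eq_of_jmod_eq_smul_of_isReduced hD hr₀ hr hpos hκQ hJ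

end Classes

end Quadratic

end Literature.NumberTheory.QuadraticFields

end
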